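import Mathlib.GroupTheory.Index
import Mathlib.GroupTheory.Coset.Basic
import Mathlib.LinearAlgebra.BilinearForm.Properties
import Mathlib.LinearAlgebra.Dual.Lemmas
import Mathlib.LinearAlgebra.FreeModule.Finite.Quotient
import Mathlib.LinearAlgebra.FreeModule.PID
import Mathlib.LinearAlgebra.Dimension.Finrank
import Mathlib.RingTheory.Noetherian.Basic
import Mathlib.Tactic.Abel
import HarnessLib

/-!
# Route LinearSystemTorelli — crux `LocalTubeSpan` (stmt-HodgeConjecture-2490): congruence lemmas for Schnell's Lemma 11 (nondegenerate case)

Helper file (`--supports stmt-HodgeConjecture-2490`, line `Sketch` of the crux chain; continuation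
lead c5; preparation for discharging `Schnell2010_lemma11` in the NONDEGENERATE case from Janssen's
Theorem 2.5 (= [Schnell2010] Theorem 10) and Theorem 2.9).

Vocabulary-free lattice lemmas for the finite-index step of [Schnell2010] §7 Lemma 11 in the
nondegenerate case, where the printed last step ("the index of `Γ'` in `Γ` is at most `mq`", a
bounded-exponent statement) is replaced by a principal congruence subgroup argument:

* `localTubeSpan_exists_uniform_nsmul_mem`, `localTubeSpan_exists_nsmul_mem_of_span_eq_top` — a
  `ℤ`-submodule `Λ'` spanning `V` over `ℚ` absorbs a uniform positive multiple of any finitely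
  generated `Λ`: `d • Λ ⊆ Λ'`;
* `localTubeSpan_exists_dual_exponent` — for a NONDEGENERATE form, integral on a `ℚ`-basis `δ`,
  some `e ≥ 1` turns every functional `l` integral on `ℤδ` into a pairing: `e·l = B(v, ·)` on `ℤδ`
  with `v ∈ ℤδ` (the dual lattice has finite index over `j(ℤδ)`);
* `localTubeSpan_finiteIndex_of_congruence` — for a group `Γ` of units of `End V` preserving a
  finitely generated lattice `Λ`, any subgroup containing the principal congruence
  elements `{g | g ≡ 1 (mod cΛ) on Λ}` (`c ≥ 1`) has finite index (`Γ/H₀ ↪ End(Λ/cΛ)`).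

No named facts; no `sorry`.
-/

-- `Summit.HodgeConjecture.HodgeConjecture.Theorems` is the mandated namespace (single-conjunct summit:
-- Sub = Summit), which `linter.dupNamespace` flags on every declaration; the lakefile turns the
-- linter off tree-wide (weak option), restated here so stand-alone elaboration is warning-free too.
set_option linter.dupNamespace false

noncomputable section

namespace Summit.HodgeConjecture.HodgeConjecture.Theorems

variable {V : Type*} [AddCommGroup V] [Module ℚ V]

/-! ### Exponents of sublattices -/

omit [Module ℚ V] in
/-- A finitely generated `ℤ`-submodule `Λ` all of whose elements have a positive multiple in the
submodule `Λ'` admits a UNIFORM positive multiplier: `d • Λ ⊆ Λ'` for some `d ≥ 1` (the product of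
the multipliers of finitely many generators). [folklore] -/
theorem localTubeSpan_exists_uniform_nsmul_mem (Λ Λ' : Submodule ℤ V) (hΛ : Λ.FG)
    (h : ∀ x ∈ Λ, ∃ n : ℕ, 0 < n ∧ (n : ℤ) • x ∈ Λ') :
    ∃ d : ℕ, 0 < d ∧ ∀ x ∈ Λ, (d : ℤ) • x ∈ Λ' := by
  classical
  obtain ⟨S, hS⟩ := hΛ
  choose! n hnpos hnmem using h
  have hSΛ : ∀ s ∈ S, (s : V) ∈ Λ := fun s hs => hS ▸ Submodule.subset_span hs
  refine ⟨∏ s ∈ S, n s, Finset.prod_pos fun s hs => hnpos s (hSΛ s hs), ?_⟩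
  intro x hx
  rw [← hS] at hx
  induction hx using Submodule.span_induction with
  | mem s hs =>
    obtain ⟨m, hm⟩ : n s ∣ ∏ t ∈ S, n t := Finset.dvd_prod_of_mem n hs
    rw [hm, Nat.cast_mul, mul_comm, mul_smul]
    exact Λ'.smul_mem _ (hnmem s (hSΛ s hs))
  | zero => rw [smul_zero]; exact Λ'.zero_mem
  | add x y _ _ hx hy => rw [smul_add]; exact Λ'.add_mem hx hy
  | smul a x _ hx => rw [smul_comm]; exact Λ'.smul_mem a hx

/-- If `Λ'` is a `ℤ`-submodule spanning the `ℚ`-space `V`, every vector has a positive integer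
multiple in `Λ'`. [folklore] -/
theorem localTubeSpan_exists_nsmul_mem_of_span_eq_top (Λ' : Submodule ℤ V)
    (hΛ' : Submodule.span ℚ (Λ' : Set V) = ⊤) (x : V) :
    ∃ n : ℕ, 0 < n ∧ (n : ℤ) • x ∈ Λ' := by
  have hx : x ∈ Submodule.span ℚ (Λ' : Set V) := by rw [hΛ']; trivial
  induction hx using Submodule.span_induction with
  | mem y hy => exact ⟨1, one_pos, by rwa [Nat.cast_one, one_smul]⟩
  | zero => exact ⟨1, one_pos, by rw [smul_zero]; exact Λ'.zero_mem⟩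
  | add y z _ _ hy hz =>
    obtain ⟨a, ha, hay⟩ := hy
    obtain ⟨b, hb, hbz⟩ := hz
    refine ⟨a * b, Nat.mul_pos ha hb, ?_⟩
    rw [smul_add, Nat.cast_mul]
    refine Λ'.add_mem ?_ ?_
    · rw [mul_comm, mul_smul]; exact Λ'.smul_mem _ hay
    · rw [mul_smul]; exact Λ'.smul_mem _ hbz
  | smul q y _ hy =>
    obtain ⟨a, ha, hay⟩ := hy
    refine ⟨q.den * a, Nat.mul_pos q.den_pos ha, ?_⟩
    have e2 : ((q.den : ℕ) : ℤ) • (q • y) = q.num • y := by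
      rw [← Int.cast_smul_eq_zsmul ℚ, ← Int.cast_smul_eq_zsmul ℚ q.num, smul_smul, Int.cast_natCast,
        Rat.den_mul_eq_num]
    rw [Nat.cast_mul, mul_comm, mul_smul, e2, smul_comm]
    exact Λ'.smul_mem _ hay

/-! ### The dual lattice of a nondegenerate integral form has finite exponent over `j(ℤδ)` -/

/-- Finitely many rationals, doubly indexed, have a common positive denominator. [folklore] -/
theorem localTubeSpan_exists_common_den₂ {r : ℕ} (q : Fin r → Fin r → ℚ) :
    ∃ (e : ℕ) (a : Fin r → Fin r → ℤ), 0 < e ∧ ∀ i j, (a i j : ℚ) = e * q i j := by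
  classical
  refine ⟨∏ p : Fin r × Fin r, (q p.1 p.2).den,
    fun i j => (∏ p ∈ Finset.univ.erase (i, j), ((q p.1 p.2).den : ℤ)) * (q i j).num,
    Finset.prod_pos fun p _ => (q p.1 p.2).den_pos, fun i j => ?_⟩
  rw [← Finset.prod_erase_mul Finset.univ (fun p : Fin r × Fin r => (q p.1 p.2).den)
    (Finset.mem_univ (i, j))]
  push_cast
  rw [mul_assoc, Rat.den_mul_eq_num]

/-- **Finite exponent of the dual lattice.**  Let `B` be a NONDEGENERATE bilinear form on the
finite-dimensional `ℚ`-space `V` and `δ` a `ℚ`-basis of `V`.  Then there is `e ≥ 1` such that for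
every linear functional `l` taking integer values on the `δᵢ` there is `v ∈ ℤδ` with
`e · l(x) = B(v, x)` for all `x` (the lattice `{l | l(ℤδ) ⊆ ℤ}` contains `j(ℤδ) = {B(v, ·)}` with
finite index; `e` clears the denominators of the `B`-duals of the dual basis). [folklore] -/
theorem localTubeSpan_exists_dual_exponent [FiniteDimensional ℚ V] (B : LinearMap.BilinForm ℚ V)
    (hBnd : B.Nondegenerate) {r : ℕ} (δ : Fin r → V) (hδ : LinearIndependent ℚ δ)
    (hsp : Submodule.span ℚ (Set.range δ) = ⊤) :
    ∃ e : ℕ, 0 < e ∧ ∀ l : V →ₗ[ℚ] ℚ, (∀ i, ∃ z : ℤ, l (δ i) = z) →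
      ∃ v ∈ Submodule.span ℤ (Set.range δ), ∀ x : V, (e : ℚ) * l x = B v x := by
  classical
  let bδ : Module.Basis (Fin r) ℚ V := Module.Basis.mk hδ (by rw [hsp])
  have hbδ : ∀ i, bδ i = δ i := fun i => Module.Basis.mk_apply hδ (by rw [hsp]) i
  -- the `B`-duals `w i` of the coordinate functionals: `B (w i) x = coord i x`
  let w : Fin r → V := fun i => (B.toDual hBnd).symm (bδ.coord i)
  have hw : ∀ i x, B (w i) x = bδ.coord i x := fun i x => by
    rw [← LinearMap.BilinForm.toDual_def (B := B) hBnd, LinearEquiv.apply_symm_apply]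
  -- their coordinates, and a common denominator `e`
  obtain ⟨e, a, hepos, hea⟩ := localTubeSpan_exists_common_den₂ fun i j => bδ.repr (w i) j
  have hew : ∀ i, (e : ℚ) • w i ∈ Submodule.span ℤ (Set.range δ) := fun i => by
    have hrep : w i = ∑ j, bδ.repr (w i) j • δ j := by
      conv_lhs => rw [← bδ.sum_repr (w i)]
      simp only [hbδ]
    rw [hrep, Finset.smul_sum]
    refine Submodule.sum_mem _ fun j _ => ?_
    rw [smul_smul, ← hea i j, Int.cast_smul_eq_zsmul]
    exact Submodule.smul_mem _ _ (Submodule.subset_span ⟨j, rfl⟩)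
  refine ⟨e, hepos, fun l hl => ?_⟩
  choose z hz using hl
  refine ⟨∑ i, z i • ((e : ℚ) • w i), Submodule.sum_mem _ fun i _ => Submodule.smul_mem _ _ (hew i),
    fun x => ?_⟩
  -- `l = Σ l(δ i) • coord i`
  have hlx : l x = ∑ i, l (δ i) * bδ.coord i x := by
    conv_lhs => rw [← bδ.sum_dual_apply_smul_coord l]
    simp only [LinearMap.coe_sum, Finset.sum_apply, LinearMap.smul_apply, smul_eq_mul, hbδ]
  rw [hlx, Finset.mul_sum, map_sum, LinearMap.coe_sum, Finset.sum_apply]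
  refine Finset.sum_congr rfl fun i _ => ?_
  rw [← Int.cast_smul_eq_zsmul ℚ, smul_smul, map_smul, LinearMap.smul_apply, smul_eq_mul, hw, hz]
  ring

/-! ### Principal congruence subgroups have finite index -/

/-- **Finite index of principal congruence subgroups.**  Let `Γ` be a group of units of `End V`
preserving a finitely generated `ℤ`-submodule `Λ` (of the `ℚ`-space `V`), and `c ≥ 1`.  Any subgroup `H`
containing every `g ∈ Γ` with `g x - x ∈ cΛ` for all `x ∈ Λ` has finite index in `Γ`: the
congruence elements form the kernel `H₀` of the action of `Γ` on the finite set `Λ/cΛ`, and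
`Γ/H₀` embeds into the finite set of self-maps of `Λ/cΛ`. [folklore] -/
theorem localTubeSpan_finiteIndex_of_congruence (Γ : Subgroup (V →ₗ[ℚ] V)ˣ) (Λ : Submodule ℤ V)
    (hΛfg : Λ.FG)
    (hΓΛ : ∀ g ∈ Γ, ∀ x ∈ Λ, ((g : (V →ₗ[ℚ] V)ˣ) : V →ₗ[ℚ] V) x ∈ Λ) (c : ℕ) (hc : 0 < c)
    (H : Subgroup (V →ₗ[ℚ] V)ˣ)
    (hH : ∀ g ∈ Γ, (∀ x ∈ Λ, ∃ y ∈ Λ, ((g : (V →ₗ[ℚ] V)ˣ) : V →ₗ[ℚ] V) x - x = (c : ℤ) • y) →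
      g ∈ H) :
    (H.subgroupOf Γ).FiniteIndex := by
  classical
  -- `Λ` is free of finite rank and `Λ / cΛ` is finite
  have htf : IsAddTorsionFree V := IsAddTorsionFree.of_module_rat V
  haveI : Module.Finite ℤ Λ := Module.Finite.iff_fg.2 hΛfg
  haveI : Module.Free ℤ Λ := inferInstance
  let mc : Λ →ₗ[ℤ] Λ := (c : ℤ) • LinearMap.id
  have hmc_inj : Function.Injective mc := by
    intro x y hxy
    have : (c : ℤ) • x = (c : ℤ) • y := hxy
    exact smul_right_injective Λ (by exact_mod_cast hc.ne') this
  let cΛ : Submodule ℤ Λ := LinearMap.range mc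
  have hmem_cΛ : ∀ x : Λ, x ∈ cΛ ↔ ∃ y : Λ, (c : ℤ) • y = x := fun x => by
    simp only [cΛ, LinearMap.mem_range, mc, LinearMap.smul_apply, LinearMap.id_apply]
  haveI : Finite (Λ ⧸ cΛ) :=
    Submodule.finiteQuotientOfFreeOfRankEq cΛ (LinearMap.finrank_range_of_inj hmc_inj)
  -- the restriction of `g ∈ Γ` to `Λ`, and the induced self-map of `Λ / cΛ`
  let res : Γ → (Λ →ₗ[ℤ] Λ) := fun g =>
    (((g : (V →ₗ[ℚ] V)ˣ) : V →ₗ[ℚ] V).restrictScalars ℤ).restrict fun x hx => hΓΛ g g.2 x hx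
  have hres : ∀ (g : Γ) (x : Λ), ((res g x : Λ) : V) = ((g : (V →ₗ[ℚ] V)ˣ) : V →ₗ[ℚ] V) x :=
    fun g x => rfl
  have hres_le : ∀ g : Γ, cΛ ≤ cΛ.comap (res g) := fun g x hx => by
    obtain ⟨y, rfl⟩ := (hmem_cΛ x).1 hx
    rw [Submodule.mem_comap, map_smul]
    exact (hmem_cΛ _).2 ⟨res g y, rfl⟩
  let ψ : Γ → (Λ ⧸ cΛ) → (Λ ⧸ cΛ) := fun g => cΛ.mapQ cΛ (res g) (hres_le g)
  have hψmk : ∀ (g : Γ) (x : Λ), ψ g (Submodule.Quotient.mk x) = Submodule.Quotient.mk (res g x) :=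
    fun g x => rfl
  have hres_mul : ∀ (g h : Γ) (x : Λ), res (g * h) x = res g (res h x) := fun g h x =>
    Subtype.ext (by rw [hres, hres, hres, Subgroup.coe_mul, Units.val_mul, Module.End.mul_apply])
  have hres_one : ∀ x : Λ, res 1 x = x := fun x =>
    Subtype.ext (by rw [hres, Subgroup.coe_one, Units.val_one, Module.End.one_apply])
  have hψmul : ∀ g h : Γ, ψ (g * h) = ψ g ∘ ψ h := fun g h => by
    funext q
    induction q using Submodule.Quotient.induction_on with
    | H x => simp only [Function.comp_apply, hψmk, hres_mul]
  have hψone : ψ 1 = id := by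
    funext q
    induction q using Submodule.Quotient.induction_on with
    | H x => rw [hψmk, hres_one]; rfl
  -- the kernel `H₀` of the action, a finite-index subgroup of `Γ`
  let H₀ : Subgroup Γ :=
    { carrier := {g | ψ g = id}
      one_mem' := hψone
      mul_mem' := fun {g h} hg hh => by
        change ψ (g * h) = id
        rw [hψmul, hg, hh]; rfl
      inv_mem' := fun {g} hg => by
        change ψ g⁻¹ = id
        have := hψmul g g⁻¹
        rw [mul_inv_cancel, hψone, hg] at this
        exact this.symm }
  have hH₀mem : ∀ g : Γ, g ∈ H₀ ↔ ψ g = id := fun g => Iff.rfl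
  letI : Setoid Γ := QuotientGroup.leftRel H₀
  have hker : ∀ a b : Γ, ψ a = ψ b ↔ a⁻¹ * b ∈ H₀ := fun a b => by
    rw [hH₀mem, hψmul]
    constructor
    · intro h
      rw [← h, ← hψmul, inv_mul_cancel, hψone]
    · intro h
      have : ψ a ∘ (ψ a⁻¹ ∘ ψ b) = ψ a ∘ id := congrArg (fun f => ψ a ∘ f) h
      rw [← hψmul, ← hψmul, mul_inv_cancel_left, Function.comp_id] at this
      exact this.symm
  let Ψ : Γ ⧸ H₀ → (Λ ⧸ cΛ) → (Λ ⧸ cΛ) :=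
    Quotient.lift ψ fun a b hab => (hker a b).2 (QuotientGroup.leftRel_apply.1 hab)
  have hΨinj : Function.Injective Ψ := by
    intro p q hpq
    induction p using QuotientGroup.induction_on with
    | H a =>
      induction q using QuotientGroup.induction_on with
      | H b => exact QuotientGroup.eq.2 ((hker a b).1 hpq)
  haveI : Finite (Γ ⧸ H₀) := Finite.of_injective Ψ hΨinj
  haveI : H₀.FiniteIndex := Subgroup.finiteIndex_of_finite_quotient
  -- `H₀ ≤ H`
  refine Subgroup.finiteIndex_of_le (H := H₀) fun g hg => ?_
  rw [Subgroup.mem_subgroupOf]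
  refine hH g g.2 fun x hx => ?_
  have h1 : ψ g (Submodule.Quotient.mk ⟨x, hx⟩) = Submodule.Quotient.mk ⟨x, hx⟩ := by
    rw [(hH₀mem g).1 hg]; rfl
  rw [hψmk, Submodule.Quotient.eq] at h1
  obtain ⟨y, hy⟩ := (hmem_cΛ _).1 h1
  refine ⟨y, y.2, ?_⟩
  have := congrArg (fun z : Λ => (z : V)) hy
  simp only [Submodule.coe_sub, Submodule.coe_smul, hres] at this
  exact this.symm

end Summit.HodgeConjecture.HodgeConjecture.Theorems

end
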